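import Summits.HodgeConjecture.CorCM.Model.FourierIntertwine
import HarnessLib

/-!
# COR-CM model layer (row M22 `Fact_algDuality`, clause (ii)), adjoint form of the intertwining identity

Cell `pub-hodgecm2` (COR-CM), seat b23; a COROLLARY of seat b22's `CorCM/Model/FourierIntertwine.lean`, in the same
generality (graded multilinear algebra on the singular cohomology of any topological space `Y`, any commutative
coefficient ring `R`; nothing about algebraic cycles is asserted).

For the Fourier-type operator `D z = Σ_{c : Fin i → Fin N} τ(z ⌣ m_i(b ∘ c)) • m_i(y ∘ c)` b22 proves
`G^*(D(F^* z)) = λ • D z` from `τ ∘ F^* = λ • τ`, a family `b'` with `F^* b'_a = b_a` and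
`Σ_a b'_a ⊗ G^* y_a = Σ_a b_a ⊗ y_a` (or, Rosati form, from an AUTOMORPHISM `α` through which `F^*` acts on
`H¹`).  THIS FILE records the ADJOINT FORM, which needs no `b'`, no automorphism and no invertibility:

* `map_fourierSum_map_eq_smul_of_adjoint` — if `τ ∘ F^* = λ • τ` on `Hᵏ` and the **adjoint tensor identity**
  `Σ_a F^* b_a ⊗ y_a = Σ_a b_a ⊗ G^* y_a` holds in `H¹ ⊗ H¹`, then `G^*(D(F^* z)) = λ • D z` for all `z ∈ Hʲ`.

On the COR-CM model (`Y = P(ℂ)`, `F = Ma`, `G = Mb` acting diagonally by `a`, `ā ∈ K`, `λ = N_{K/ℚ}(a)⁴` by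
`Fact_deg_diag`) the adjoint identity is LITERALLY the Rosati tensor identity
`Σ_a Ma^*(b_a) ⊗ y_a = Σ_a b_a ⊗ Mb^*(y_a)` of the R2→P junction (model-1's M22 INTERFACE v1, piece D3), which is
`ℚ`-linear in `a` and holds for `a = 0` as well — so clause (ii) follows for EVERY `a ∈ K` in one stroke (no separate
treatment of `a = 0`, where `Ma^*` is not invertible on `H¹`).

Proof: b22's transport lemma `fourierSum_eq_of_sum_tmul_eq` applied to the pairs `(F^* ∘ b, y)` and `(b, G^* ∘ y)`
at the class `F^* z`, then multiplicativity of `F^*`, `G^*` on the cup monomials (`map_cupPowOne`, `cupProduct_map`).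
[cite: Kleiman1968AlgebraicCycles, Appendix 2A, 2A9–2A11]
-/

noncomputable section

open Literature.AlgebraicTopology.SingularHomology
open scoped TensorProduct

universe u v

namespace Summit.HodgeConjecture.CorCM.Model

variable {R : Type v} [CommRing R] {Y : Type u} [TopologicalSpace Y]

/-- **Intertwining identity, adjoint form.**  Let `F, G : Y → Y` be continuous, `λ ∈ R` with
`τ ∘ F^* = λ • τ` on `Hᵏ(Y; R)`, and let `b, y : Fin N → H¹(Y; R)` satisfy the ADJOINT TENSOR IDENTITY
`Σ_a F^* b_a ⊗ y_a = Σ_a b_a ⊗ G^* y_a` in `H¹ ⊗ H¹` ("`F^*|_{H¹}` and `G^*|_{H¹}` are mutually adjoint for the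
bilinear form with dual families `b`, `y`").  Then for `D z = Σ_c τ(z ⌣ m_i(b ∘ c)) • m_i(y ∘ c)` (`j + i = k`) one has
`G^*(D(F^* z)) = λ • D z` for every `z ∈ Hʲ(Y; R)`.  No invertibility of `F^*` is needed (on the COR-CM model this
covers the diagonal action of every `a ∈ K`, including `a = 0`). [cite: Kleiman1968AlgebraicCycles, Appendix 2A, 2A9–2A11] -/
theorem map_fourierSum_map_eq_smul_of_adjoint {N i j k : ℕ} (hk : j + i = k)
    (τ : singularCohomology R R Y k →ₗ[R] R) (F G : C(Y, Y)) (lam : R)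
    (hτ : τ ∘ₗ (singularCohomology.map R R F k).hom = lam • τ)
    (b y : Fin N → singularCohomology R R Y 1)
    (hadj : ∑ a : Fin N, singularCohomology.map R R F 1 (b a) ⊗ₜ[R] y a =
      ∑ a : Fin N, b a ⊗ₜ[R] singularCohomology.map R R G 1 (y a))
    (z : singularCohomology R R Y j) :
    singularCohomology.map R R G i
        (∑ c : Fin i → Fin N, τ (cupProduct hk (singularCohomology.map R R F j z) (cupPowOne R Y i (b ∘ c))) •
          cupPowOne R Y i (y ∘ c)) =
      lam • ∑ c : Fin i → Fin N, τ (cupProduct hk z (cupPowOne R Y i (b ∘ c))) • cupPowOne R Y i (y ∘ c) := by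
  -- b22's transport lemma for the pairs `(F^* ∘ b, y)` and `(b, G^* ∘ y)`, at the class `F^* z`
  have key := fourierSum_eq_of_sum_tmul_eq hk τ (fun a => singularCohomology.map R R F 1 (b a)) y
    b (fun a => singularCohomology.map R R G 1 (y a)) hadj (singularCohomology.map R R F j z)
  -- left side of `key`: `Σ_c τ(F^* z ⌣ F^* m_i(b ∘ c)) • m_i(y ∘ c) = λ • D z`
  have hL : ∀ c : Fin i → Fin N,
      τ (cupProduct hk (singularCohomology.map R R F j z)
        (cupPowOne R Y i ((fun a => singularCohomology.map R R F 1 (b a)) ∘ c))) =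
        lam * τ (cupProduct hk z (cupPowOne R Y i (b ∘ c))) := by
    intro c
    have hm : cupPowOne R Y i ((fun a => singularCohomology.map R R F 1 (b a)) ∘ c) =
        singularCohomology.map R R F i (cupPowOne R Y i (b ∘ c)) := by
      rw [map_cupPowOne]
      rfl
    rw [hm, ← cupProduct_map]
    have := LinearMap.congr_fun hτ (cupProduct hk z (cupPowOne R Y i (b ∘ c)))
    simpa only [LinearMap.coe_comp, Function.comp_apply, LinearMap.smul_apply, smul_eq_mul] using this
  -- right side of `key`: `Σ_c τ(F^* z ⌣ m_i(b ∘ c)) • G^* m_i(y ∘ c) = G^*(D(F^* z))`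
  have hR : ∀ c : Fin i → Fin N,
      cupPowOne R Y i ((fun a => singularCohomology.map R R G 1 (y a)) ∘ c) =
        singularCohomology.map R R G i (cupPowOne R Y i (y ∘ c)) := by
    intro c
    rw [map_cupPowOne]
    rfl
  calc singularCohomology.map R R G i
        (∑ c : Fin i → Fin N, τ (cupProduct hk (singularCohomology.map R R F j z) (cupPowOne R Y i (b ∘ c))) •
          cupPowOne R Y i (y ∘ c))
      = ∑ c : Fin i → Fin N, τ (cupProduct hk (singularCohomology.map R R F j z) (cupPowOne R Y i (b ∘ c))) •
          cupPowOne R Y i ((fun a => singularCohomology.map R R G 1 (y a)) ∘ c) := by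
        rw [map_sum]
        refine Finset.sum_congr rfl fun c _ => ?_
        rw [map_smul, hR c]
    _ = ∑ c : Fin i → Fin N, τ (cupProduct hk (singularCohomology.map R R F j z)
          (cupPowOne R Y i ((fun a => singularCohomology.map R R F 1 (b a)) ∘ c))) • cupPowOne R Y i (y ∘ c) :=
        key.symm
    _ = ∑ c : Fin i → Fin N, lam • (τ (cupProduct hk z (cupPowOne R Y i (b ∘ c))) • cupPowOne R Y i (y ∘ c)) := by
        refine Finset.sum_congr rfl fun c _ => ?_
        rw [hL c, mul_smul]
    _ = lam • ∑ c : Fin i → Fin N, τ (cupProduct hk z (cupPowOne R Y i (b ∘ c))) • cupPowOne R Y i (y ∘ c) := by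
        rw [Finset.smul_sum]

/-- **Adjoint form, operator version**: under the hypotheses of `map_fourierSum_map_eq_smul_of_adjoint`, every
`R`-linear `D : Hʲ(Y; R) → Hⁱ(Y; R)` with `D z = Σ_c τ(z ⌣ m_i(b ∘ c)) • m_i(y ∘ c)` satisfies
`G^* ∘ D ∘ F^* = λ • D` as linear maps (the literal shape of clause (ii) of `Fact_algDuality`:
`pull Mb i ∘ₗ D ∘ₗ pull Ma j = N(a)⁴ • D`). [cite: Kleiman1968AlgebraicCycles, Appendix 2A, 2A9–2A11] -/
theorem comp_comp_eq_smul_of_adjoint {N i j k : ℕ} (hk : j + i = k)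
    (τ : singularCohomology R R Y k →ₗ[R] R) (F G : C(Y, Y)) (lam : R)
    (hτ : τ ∘ₗ (singularCohomology.map R R F k).hom = lam • τ)
    (b y : Fin N → singularCohomology R R Y 1)
    (hadj : ∑ a : Fin N, singularCohomology.map R R F 1 (b a) ⊗ₜ[R] y a =
      ∑ a : Fin N, b a ⊗ₜ[R] singularCohomology.map R R G 1 (y a))
    (D : singularCohomology R R Y j →ₗ[R] singularCohomology R R Y i)
    (hD : ∀ z, D z = ∑ c : Fin i → Fin N, τ (cupProduct hk z (cupPowOne R Y i (b ∘ c))) • cupPowOne R Y i (y ∘ c)) :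
    (singularCohomology.map R R G i).hom ∘ₗ D ∘ₗ (singularCohomology.map R R F j).hom = lam • D := by
  refine LinearMap.ext fun z => ?_
  rw [LinearMap.comp_apply, LinearMap.comp_apply, LinearMap.smul_apply, hD, hD]
  exact map_fourierSum_map_eq_smul_of_adjoint hk τ F G lam hτ b y hadj z

end Summit.HodgeConjecture.CorCM.Model

end
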